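/-
Copyright (c) 2026 the pub-hodgecm-mathlib formalisation cell (harness21).  Prover seat hodgecm-mathlib-LH4-p09 (g8), req620 Track A «(D-RAM) FOUR-FRAME» squad
(heir dealer LH4-plan (g13) WORD #66 (2): (T-2tok) for F0P3a-p01 (g36)'s level trunks).  2026-09-04.
-/
import Summits.HodgeConjecture.HodgeConjecture.Theorems.F0P3cDyRamLabelledTwoTokenReductions          -- (this seat) T1: reductions; brings K2/K4 (vacuity), K-reads
import Summits.HodgeConjecture.HodgeConjecture.Theorems.F0P3cDyRamLabelledKappaSqTokenCells            -- ★ p859864 (this seat) K6: `sqToken_differences`, `glueRatio_sqToken_eq`, `not_exists_common_witness_sq`; brings K3 ★ p859777 (H genuine heads, `modelToken_data_H`, bridge)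
import HarnessLib

/-!
# (D-RAM) four-frame, STAGE 1b — (T-2tok) HEADS, core-hanging: the TWO-TOKEN labelled κ-cells of `H (2ρ, 2ρ, 2ρ)` at the letters of record
# `L₁ = [D₁ M ⊆ ϖ^{ℓ₁} M]`, `L₂ = [D₂ M ⊆ ϖ^{ℓ₂} M]` (`D₁ = diag(α−1, β−1, 0)`, `D₂ = D₁²`) on an equal-depth datum `n₁ = n₂` — equilateral foot and tube

Helper brick for dealer LH4-plan (g13) WORD #66 (2) ∕ F0P3a-p01 (g36) 11:43Z (T-2tok): `Theorems/` only, statement-first, ★-only imports, lane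
`--supports stmt-HodgeConjecture-24833 --as helper`; it PAYS NO tier-0 row (count-neutral).  K6-shaped: discharged except one glue-witness binder `f₀` (as in ★ κH)
whose premise is the ★ bridge inequality, and the symbolic D₂ read `|(β−1)² − (α−1)²| ≤ |ϖ|^{ℓ₂+ρ}` (possible cancellation at `n₁ = n₂`, not asserted).

ON AN EQUAL-DEPTH DATUM BOTH TOKENS ARE ON THE LOCUS (`k₁ = n₂`, `k₂ = 2n₂`).  EQUILATERAL FOOT (`n₁ = n₂ = n₃ = m`, `ρ ≤ m < 2ρ`): `D₁` is always GENUINE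
(`m < 2ρ ≤ ℓ₁ + 2ρ`), with token ball `B(−g₀, E₁)`, `E₁ = ℓ₁ + 2ρ − m ≥ 2ρ − m = e₀` — concentric with and finer than ★ (D2)'s stability ball; `D₂` is VACUOUS iff
`ℓ₂ + 2ρ ≤ 2m`, else genuine with ball `B(−g₀², E₂)` DISJOINT from `B(−g₀, E₁)` (★ `not_exists_common_witness_sq`).  Hence (§2)
`Σᶠ_{H, L₁ ∧ L₂} κᵢ·w = [ℓ₂ + 2ρ ≤ 2m] · [reads₂] · [ℓ₁ + ρ ≤ m ∧ E₁ ≤ m − d + 1 ∧ 2d − 1 ≤ E₁] · χᴴᵢ(f₀) · q^{2ρ−⌈E₁∕2⌉}` (`f₀` any fixed witness of the bridge).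
TUBE (`n₁ = n₂ ≥ 2ρ`, `n₃ ≥ n₂`) under the level guard `ℓ₂ ≤ 2ρ` (`D₂` vacuous): `D₁` vacuous (`ℓ₁ + 2ρ ≤ n₂`) ⇒ ★ κH's tube value `0`; `D₁` genuine ⇒ the one-token
`D₁` tube cell: `[reads₂] · [ℓ₁ + ρ ≤ n₂ ∧ n₃ = n₂ ∧ E₁ ≤ n₃ − d + 1 ∧ 2d − 1 ≤ E₁] · χᴴᵢ(f₀) · q^{2ρ−⌈E₁∕2⌉}` (§3).

* §1 `exists_fixed_near_neg_glueUnit_iff` (the ★ bridge in `f + g₀` form on an equal-depth datum).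
* §2 **`finsum_kappaCount_mul_stabiliserWeight_stratum_H_sep_levels_foot`**.   §3 **`finsum_kappaCount_mul_stabiliserWeight_stratum_H_sep_levels_tube`**.

HONEST LABEL: helper organs for HYPOTHESES (two-token trunks ★ p859769 ∕ p859848); STAGE-1b tier-0 rows T₊∕T₋∕regular and the ED. 5∕6 law stubs stay OPEN; HC_CM is
proved only modulo the 7 printed citations (2 remaining named inputs: hLiu418 = `stmt-HodgeConjecture-24832`, h413 = `stmt-HodgeConjecture-24833`) until rung 0 closes.

## References
* [Kottwitz1986BaseChangeUnits] R. E. Kottwitz, *Base change for unit elements of Hecke algebras*, Compositio Math. 60 (1986), §1 pp. 240–241 (κ-orbital integrals of units as signed lattice counts modulo the torus).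
* [LanglandsShelstad1987] R. P. Langlands, D. Shelstad, *On the definition of transfer factors*, Math. Ann. 278 (1987), §3 (κ as a character).
* [Rogawski1990] J. D. Rogawski, *Automorphic Representations of Unitary Groups in Three Variables*, Ann. of Math. Stud. 123 (1990), §4.9 Prop. 4.9.1 (a)(b) p. 55.
* [Serre1979] J.-P. Serre, *Local Fields*, GTM 67 (1979), Ch. V §3 Prop. 5, Cor. 3 (norm residue symbol behind `ω` and the glue-unit rationality depth).
-/

set_option autoImplicit false

noncomputable section

namespace Summit.HodgeConjecture.HodgeConjecture.Cruxes.H413.F0P3cDyRamLabelledKappaTwoTokenCoreHanging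

open Matrix WithZero
open Literature.NumberTheory.Automorphic Literature.NumberTheory.Automorphic.HermitianLattice Literature.NumberTheory.Automorphic.UnitaryGroup
open Literature.NumberTheory.Automorphic.UnitaryLatticeTree Literature.NumberTheory.Automorphic.UnitaryThreeFourFrame
open Literature.NumberTheory.LocalFields.WildQuadraticDatum
open Summit.HodgeConjecture.HodgeConjecture.Cruxes.H413.F0P3cDyRamDiagonalTorusDefs
open Summit.HodgeConjecture.HodgeConjecture.Cruxes.H413.F0P3cDyRamDiagonalStrataDefs
open Summit.HodgeConjecture.HodgeConjecture.Cruxes.H413.F0P3cDyRamDiagonalKappaCountDefs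
open Summit.HodgeConjecture.HodgeConjecture.Cruxes.H413.F0P3cDyRamDiagonalGluedStabiliserIndex (ne_zero_and_v_lt_one_of_v_eq_exp)
open Summit.HodgeConjecture.HodgeConjecture.Cruxes.H413.F0P3cDyRamDiagonalKappaCoreHangingSocket (v_glueUnit_letters finsum_kappaCount_mul_stabiliserWeight_hasAxis_H)
open Summit.HodgeConjecture.HodgeConjecture.Cruxes.H413.F0P3cDyRamElementDatumParity (isoceles_of_isElementDatum)
open Summit.HodgeConjecture.HodgeConjecture.Cruxes.H413.F0P3cDyRamGlueUnitRationalityDepth (exists_fixed_near_glueUnit_iff_le)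
open Summit.HodgeConjecture.HodgeConjecture.Cruxes.H413.F0P3cDyRamFourFrameCensusDefs
open Summit.HodgeConjecture.HodgeConjecture.Cruxes.H413.F0P3cDyRamLabelledSplitStrata (finsum_mem_sep_eq_ite_of_forall_iff)
open Summit.HodgeConjecture.HodgeConjecture.Cruxes.H413.F0P3cDyRamLabelledGluedLocusCensusFoot (glueRatio_modelToken_eq)
open Summit.HodgeConjecture.HodgeConjecture.Cruxes.H413.F0P3cDyRamLabelledCoreHangingLocusCensusClosed (v_glueUnit_eq_one modelToken_data_H)
open Summit.HodgeConjecture.HodgeConjecture.Cruxes.H413.F0P3cDyRamLabelledKappaCoreHangingLocusClosed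
open Summit.HodgeConjecture.HodgeConjecture.Cruxes.H413.F0P3cDyRamLabelledKappaSqTokenCells (glueRatio_sqToken_eq sqToken_differences not_exists_common_witness_sq)
open Summit.HodgeConjecture.HodgeConjecture.Cruxes.H413.F0P3cDyRamLabelledTwoTokenReductions
open scoped Valued WithZero Matrix MatrixGroups

variable {K : Type} [Field K] [Valued K ℤᵐ⁰] [CompleteSpace K] [Fintype 𝓀[K]] {σ : K →+* K} {ϖ : K} {d t : ℕ} {α β : K} {N₀ n₁ n₂ n₃ : ℕ}
  {T : GL (Fin 3) K}

/-! ## §1  The glue-unit bridge in `f + g₀` form on an equal-depth datum -/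

omit [CompleteSpace K] [Fintype 𝓀[K]] in
/-- **THE ★ BRIDGE, `f + g₀` FORM**: on an equal-depth datum (`n₁ = n₂`, so `|g₀| = 1`, `g₀ = (β−1)∕(α−1)`) and with `d ≤ N₀`: a `σ`-fixed `f` with `|f + g₀| ≤ |ϖ|^j`
exists iff `j ≤ n₃ − d + 1` (★ `exists_fixed_near_glueUnit_iff_le`, `f ↦ −f`). [cite: Serre1979, Ch. V §3 Prop. 5, Cor. 3] [cite: Rogawski1990, §4.9 Prop. 4.9.1 (b) p. 55] -/
theorem exists_fixed_near_neg_glueUnit_iff (hD : IsRamifiedQuadraticDatum σ ϖ d t) (hE : IsElementDatum σ ϖ N₀ α β n₁ n₂ n₃) (hN₀ : d ≤ N₀) (h12 : n₁ = n₂) (j : ℕ) :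
    (∃ f : K, σ f = f ∧ Valued.v (f + (β - 1) / (α - 1)) ≤ Valued.v ϖ ^ j) ↔ j ≤ n₃ - d + 1 := by
  obtain ⟨hσ, hvσ, hϖ, hfix, hd, hd1, -⟩ := id hD
  obtain ⟨hαn, hβn, -, hα1, hβ1, h₁, h₂, h₃, -, hN2, hN3⟩ := id hE
  obtain ⟨hϖ0, hϖ1⟩ := ne_zero_and_v_lt_one_of_v_eq_exp hϖ
  have hvϖ0 : Valued.v ϖ ≠ 0 := (Valuation.ne_zero_iff _).2 hϖ0
  have hg₀ : Valued.v ((β - 1) / (α - 1)) = 1 := v_glueUnit_eq_one hvϖ0 (h12 ▸ h₁) h₂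
  have hαd : Valued.v (α - 1) ≤ Valued.v ϖ ^ d := by rw [h₂]; exact pow_le_pow_right_of_le_one' hϖ1.le (by omega)
  have hβd : Valued.v (β - 1) ≤ Valued.v ϖ ^ d := by rw [h₁]; exact pow_le_pow_right_of_le_one' hϖ1.le (by omega)
  have hbridge := exists_fixed_near_glueUnit_iff_le hσ hvσ hfix hϖ hd hd1 hαn hβn hα1 hβ1 hαd hβd h₃ (by omega) j
  rw [hg₀, one_mul] at hbridge
  rw [← hbridge]
  constructor
  · rintro ⟨f, hσf, hf⟩
    exact ⟨-f, by rw [map_neg, hσf], by rw [show (β - 1) / (α - 1) - -f = f + (β - 1) / (α - 1) by ring]; exact hf⟩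
  · rintro ⟨f, hσf, hf⟩
    exact ⟨-f, by rw [map_neg, hσf], by rw [show -f + (β - 1) / (α - 1) = (β - 1) / (α - 1) - f by ring]; exact hf⟩

/-! ## §2  Equilateral foot -/

open Classical in
/-- **HEAD — TWO-TOKEN κ-WEIGHTED H CELL AT THE LETTERS OF RECORD, EQUILATERAL FOOT** (`n₁ = n₂ = n₃ = m`, `ρ ≤ m < 2ρ`; tokens `D₁` at `ℓ₁`, `D₂` at `ℓ₂`;
`E₁ = ℓ₁ + 2ρ − m`; `f₀` any `σ`-fixed element with `|f₀ + g₀| ≤ |ϖ|^{E₁}` when the bridge inequality `E₁ ≤ m − d + 1` holds):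
`Σᶠ_{M ∈ H(2ρ,2ρ,2ρ), D₁M ⊆ ϖ^{ℓ₁}M ∧ D₂M ⊆ ϖ^{ℓ₂}M} κᵢ(M)·w(M) = [ℓ₂ + 2ρ ≤ 2m] · [reads₂] · [ℓ₁ + ρ ≤ m ∧ E₁ ≤ m − d + 1 ∧ 2d − 1 ≤ E₁] · χᴴᵢ(f₀) · q^{2ρ−⌈E₁∕2⌉}`
— `D₂` vacuous ⇒ T1 reduction to the `D₁` cell (K3 foot heads, concentric balls, finer exponent `E₁`); `D₂` genuine ⇒ `0` (T1 §4, disjoint balls).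
[cite: Kottwitz1986BaseChangeUnits, §1 pp. 240–241] [cite: LanglandsShelstad1987, §3] [cite: Serre1979, Ch. V §3 Prop. 5, Cor. 3] [cite: Rogawski1990, §4.9 Prop. 4.9.1 (a)(b) p. 55] -/
theorem finsum_kappaCount_mul_stabiliserWeight_stratum_H_sep_levels_foot (hD : IsRamifiedQuadraticDatum σ ϖ d t) (h2 : Valued.v (2 : K) < 1)
    (hE : IsElementDatum σ ϖ N₀ α β n₁ n₂ n₃) (hN₀ : d ≤ N₀) (hT : (T : Matrix (Fin 3) (Fin 3) K) = Matrix.diagonal ![α, β, 1])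
    (ρ : ℕ) (hρ : 1 ≤ ρ) (h12 : n₁ = n₂) (h13 : n₁ = n₃) (hρm : ρ ≤ n₁) (hm : n₁ < 2 * ρ) (i : Fin 3) (ℓ₁ ℓ₂ : ℕ) (f₀ : K) (hσf₀ : σ f₀ = f₀)
    (hf₀ : ℓ₁ + 2 * ρ - n₁ ≤ n₁ - d + 1 → Valued.v (f₀ + (β - 1) / (α - 1)) ≤ Valued.v ϖ ^ (ℓ₁ + 2 * ρ - n₁)) :
    ∑ᶠ M ∈ {M | M ∈ stratum σ ϖ T ![2 * ρ, 2 * ρ, 2 * ρ] ∧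
        (LatticeInLevel ϖ ℓ₁ (Matrix.diagonal ![α - 1, β - 1, 0]) M ∧ LatticeInLevel ϖ ℓ₂ (Matrix.diagonal ![(α - 1) * (α - 1), (β - 1) * (β - 1), 0]) M)},
        (kappaCount σ ϖ 0 i M : ℚ) * stabiliserWeight σ M =
      if ℓ₂ + 2 * ρ ≤ 2 * n₁ then
        (if ((Valued.v ((α - 1) * (α - 1)) ≤ Valued.v ϖ ^ ℓ₂ ∧ Valued.v ((β - 1) * (β - 1)) ≤ Valued.v ϖ ^ ℓ₂ ∧ Valued.v (0 : K) ≤ Valued.v ϖ ^ ℓ₂) ∧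
              Valued.v ((β - 1) * (β - 1) - (α - 1) * (α - 1)) ≤ Valued.v ϖ ^ (ℓ₂ + ρ)) ∧ ℓ₂ + ρ ≤ 2 * n₁ then
          (if ℓ₁ + ρ ≤ n₁ ∧ ℓ₁ + 2 * ρ - n₁ ≤ n₁ - d + 1 ∧ 2 * d - 1 ≤ ℓ₁ + 2 * ρ - n₁ then
              (((![normSign σ (-(1 + f₀)), normSign σ f₀ * normSign σ (-(1 + f₀)), normSign σ f₀] : Fin 3 → ℤ) i : ℤ) : ℚ) *
                (Fintype.card 𝓀[K] : ℚ) ^ (2 * ρ - (ℓ₁ + 2 * ρ - n₁ + 1) / 2)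
            else 0)
        else 0)
      else 0 := by
  classical
  subst h12
  obtain ⟨hσ, hvσ, hϖ, hfix, hd, -, -⟩ := id hD
  obtain ⟨-, -, -, -, -, h₁, h₂, h₃, -, -, -⟩ := id hE
  obtain ⟨hϖ0, hϖ1⟩ := ne_zero_and_v_lt_one_of_v_eq_exp hϖ
  have hvϖ0 : Valued.v ϖ ≠ 0 := (Valuation.ne_zero_iff _).2 hϖ0
  obtain ⟨hk₁, hloc₁, -, hout₁⟩ := modelToken_data_H hϖ h₁ h₂ h₃ rfl (by omega) ℓ₁ ρ
  obtain ⟨hk₂, hloc₂⟩ := sqToken_differences h₁ h₂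
  have h₃' : Valued.v (β - α) = Valued.v ϖ ^ n₁ := by rw [Valuation.map_sub_swap, h13]; exact h₃
  obtain ⟨hg₀, h1g₀⟩ := v_glueUnit_letters hϖ0 h₁ h₂ h₃'
  have hread0 : (![(α - 1) * (α - 1), (β - 1) * (β - 1), 0] : Fin 3 → K) 0 = (α - 1) * (α - 1) := rfl
  have hread1 : (![(α - 1) * (α - 1), (β - 1) * (β - 1), 0] : Fin 3 → K) 1 = (β - 1) * (β - 1) := rfl
  have hread2 : (![(α - 1) * (α - 1), (β - 1) * (β - 1), 0] : Fin 3 → K) 2 = 0 := rfl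
  have hbridge := exists_fixed_near_neg_glueUnit_iff hD hE hN₀ rfl (ℓ₁ + 2 * ρ - n₁)
  by_cases hvac₂ : ℓ₂ + 2 * ρ ≤ 2 * n₁
  · -- `D₂` vacuous: the cell is the `D₁` cell
    rw [if_pos hvac₂, finsum_stratum_H_sep_and_eq_of_vacuous_right hD T ρ hρ ℓ₁ _ ℓ₂ (2 * n₁) _ hk₂ hloc₂ hvac₂, hread0, hread1, hread2]
    by_cases hout₂ : ((Valued.v ((α - 1) * (α - 1)) ≤ Valued.v ϖ ^ ℓ₂ ∧ Valued.v ((β - 1) * (β - 1)) ≤ Valued.v ϖ ^ ℓ₂ ∧ Valued.v (0 : K) ≤ Valued.v ϖ ^ ℓ₂) ∧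
        Valued.v ((β - 1) * (β - 1) - (α - 1) * (α - 1)) ≤ Valued.v ϖ ^ (ℓ₂ + ρ)) ∧ ℓ₂ + ρ ≤ 2 * n₁
    · rw [if_pos hout₂, if_pos hout₂]
      by_cases hwit : ℓ₁ + 2 * ρ - n₁ ≤ n₁ - d + 1
      · -- a fixed witness in the finer (token) ball
        have hf := hf₀ hwit
        rw [finsum_kappaCount_mul_stabiliserWeight_stratum_H_sep_onLocus_foot_of_witness hD h2 hE hT ρ hρ rfl h13 hρm hm i ℓ₁ n₁ _ hk₁ hloc₁ (by omega)
            hσf₀ (hf.trans (pow_le_pow_right_of_le_one' hϖ1.le (by omega))) (by rw [glueRatio_modelToken_eq]; exact hf),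
          max_eq_right (show 2 * ρ - n₁ ≤ ℓ₁ + 2 * ρ - n₁ by omega)]
        simp only [hout₁]
        by_cases hℓ : ℓ₁ + ρ ≤ n₁
        · rw [if_pos hℓ]
          by_cases hdE : 2 * d - 1 ≤ ℓ₁ + 2 * ρ - n₁
          · rw [if_pos hdE, if_pos ⟨hℓ, hwit, hdE⟩]
          · rw [if_neg hdE, if_neg (fun h => hdE h.2.2)]
        · rw [if_neg hℓ, if_neg (fun h => hℓ h.1)]
      · -- no fixed witness at depth `E₁`
        rw [if_neg (fun h => hwit h.2.1)]
        refine finsum_kappaCount_mul_stabiliserWeight_stratum_H_sep_onLocus_foot_of_no_witness hD h2 hE hT ρ hρ rfl h13 hρm hm i ℓ₁ n₁ _ hk₁ hloc₁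
          (by omega) ?_
        rw [glueRatio_modelToken_eq]
        rintro ⟨f, hσf, -, hf⟩
        have := hbridge.1 ⟨f, hσf, hf⟩
        omega
    · rw [if_neg hout₂, if_neg hout₂]
  · -- `D₂` genuine: the two balls are disjoint
    rw [if_neg hvac₂]
    refine finsum_stratum_H_sep_and_eq_zero_of_no_common_witness hD h2 T ρ hρ ℓ₁ n₁ _ hk₁ hloc₁ ℓ₂ (2 * n₁) _ hk₂ hloc₂ (by omega) (by omega) ?_ _
    rw [glueRatio_modelToken_eq, glueRatio_sqToken_eq]
    exact not_exists_common_witness_sq hϖ1 hg₀ h1g₀ (by omega) (by omega) (fun f => σ f = f)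

/-! ## §3  Tube, under the square-level guard `ℓ₂ ≤ 2ρ` -/

open Classical in
/-- **HEAD — TWO-TOKEN κ-WEIGHTED H CELL AT THE LETTERS OF RECORD, TUBE** (`n₁ = n₂ ≥ 2ρ`, `ρ ≤ n₃`; `ℓ₂ ≤ 2ρ` so `D₂` is vacuous; `E₁ = ℓ₁ + 2ρ − n₂`; `f₀` any
`σ`-fixed element with `|f₀ + g₀| ≤ |ϖ|^{E₁}` when `E₁ ≤ n₃ − d + 1`):
`Σᶠ_{M ∈ H, D₁M ⊆ ϖ^{ℓ₁}M ∧ D₂M ⊆ ϖ^{ℓ₂}M} κᵢ(M)·w(M) = [reads₂] · ( 0 if ℓ₁ + 2ρ ≤ n₂ (★ κH's tube value) ;`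
`[ℓ₁ + ρ ≤ n₂ ∧ n₃ = n₂ ∧ E₁ ≤ n₃ − d + 1 ∧ 2d − 1 ≤ E₁] · χᴴᵢ(f₀) · q^{2ρ−⌈E₁∕2⌉} otherwise )`.
[cite: Kottwitz1986BaseChangeUnits, §1 pp. 240–241] [cite: LanglandsShelstad1987, §3] [cite: Serre1979, Ch. V §3 Prop. 5, Cor. 3] [cite: Rogawski1990, §4.9 Prop. 4.9.1 (a)(b) p. 55] -/
theorem finsum_kappaCount_mul_stabiliserWeight_stratum_H_sep_levels_tube (hD : IsRamifiedQuadraticDatum σ ϖ d t) (h2 : Valued.v (2 : K) < 1)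
    (hE : IsElementDatum σ ϖ N₀ α β n₁ n₂ n₃) (hN₀ : d ≤ N₀) (hT : (T : Matrix (Fin 3) (Fin 3) K) = Matrix.diagonal ![α, β, 1])
    (ρ : ℕ) (hρ : 1 ≤ ρ) (h12 : n₁ = n₂) (htube : 2 * ρ ≤ n₂) (hn₃ : ρ ≤ n₃) (i : Fin 3) (ℓ₁ ℓ₂ : ℕ) (hℓ₂ : ℓ₂ ≤ 2 * ρ) (f₀ : K) (hσf₀ : σ f₀ = f₀)
    (hf₀ : ℓ₁ + 2 * ρ - n₂ ≤ n₃ - d + 1 → Valued.v (f₀ + (β - 1) / (α - 1)) ≤ Valued.v ϖ ^ (ℓ₁ + 2 * ρ - n₂)) :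
    ∑ᶠ M ∈ {M | M ∈ stratum σ ϖ T ![2 * ρ, 2 * ρ, 2 * ρ] ∧
        (LatticeInLevel ϖ ℓ₁ (Matrix.diagonal ![α - 1, β - 1, 0]) M ∧ LatticeInLevel ϖ ℓ₂ (Matrix.diagonal ![(α - 1) * (α - 1), (β - 1) * (β - 1), 0]) M)},
        (kappaCount σ ϖ 0 i M : ℚ) * stabiliserWeight σ M =
      if ((Valued.v ((α - 1) * (α - 1)) ≤ Valued.v ϖ ^ ℓ₂ ∧ Valued.v ((β - 1) * (β - 1)) ≤ Valued.v ϖ ^ ℓ₂ ∧ Valued.v (0 : K) ≤ Valued.v ϖ ^ ℓ₂) ∧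
            Valued.v ((β - 1) * (β - 1) - (α - 1) * (α - 1)) ≤ Valued.v ϖ ^ (ℓ₂ + ρ)) ∧ ℓ₂ + ρ ≤ 2 * n₂ then
        (if ℓ₁ + 2 * ρ ≤ n₂ then 0
          else
            (if ℓ₁ + ρ ≤ n₂ ∧ n₃ = n₂ ∧ ℓ₁ + 2 * ρ - n₂ ≤ n₃ - d + 1 ∧ 2 * d - 1 ≤ ℓ₁ + 2 * ρ - n₂ then
                (((![normSign σ (-(1 + f₀)), normSign σ f₀ * normSign σ (-(1 + f₀)), normSign σ f₀] : Fin 3 → ℤ) i : ℤ) : ℚ) *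
                  (Fintype.card 𝓀[K] : ℚ) ^ (2 * ρ - (ℓ₁ + 2 * ρ - n₂ + 1) / 2)
              else 0))
      else 0 := by
  classical
  obtain ⟨hσ, hvσ, hϖ, hfix, hd, -, -⟩ := id hD
  obtain ⟨-, -, -, -, -, h₁, h₂, h₃, -, -, -⟩ := id hE
  have h23 : n₂ ≤ n₃ := by
    rcases isoceles_of_isElementDatum hD hE with ⟨-, h⟩ | ⟨h, h'⟩ | ⟨h, h'⟩ <;> omega
  obtain ⟨hϖ0, hϖ1⟩ := ne_zero_and_v_lt_one_of_v_eq_exp hϖ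
  obtain ⟨hk₁, hloc₁, h10₁, hout₁⟩ := modelToken_data_H hϖ h₁ h₂ h₃ h12 h23 ℓ₁ ρ
  obtain ⟨hk₂, hloc₂⟩ := sqToken_differences h₁ h₂
  rw [h12] at hloc₂
  have hread0 : (![(α - 1) * (α - 1), (β - 1) * (β - 1), 0] : Fin 3 → K) 0 = (α - 1) * (α - 1) := rfl
  have hread1 : (![(α - 1) * (α - 1), (β - 1) * (β - 1), 0] : Fin 3 → K) 1 = (β - 1) * (β - 1) := rfl
  have hread2 : (![(α - 1) * (α - 1), (β - 1) * (β - 1), 0] : Fin 3 → K) 2 = 0 := rfl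
  have hple : ∀ m n : ℕ, Valued.v ϖ ^ m ≤ Valued.v ϖ ^ n ↔ n ≤ m := fun m n => UnitaryLatticeTree.v_pow_le_v_pow_iff hϖ m n
  have hpeq : ∀ m n : ℕ, Valued.v ϖ ^ m = Valued.v ϖ ^ n ↔ m = n := fun m n =>
    ⟨fun h => le_antisymm ((hple n m).1 h.ge) ((hple m n).1 h.le), fun h => by rw [h]⟩
  have hbridge := exists_fixed_near_neg_glueUnit_iff hD hE hN₀ h12 (ℓ₁ + 2 * ρ - n₂)
  -- `D₂` is vacuous on the tube
  rw [finsum_stratum_H_sep_and_eq_of_vacuous_right hD T ρ hρ ℓ₁ _ ℓ₂ (2 * n₂) _ hk₂ hloc₂ (by omega), hread0, hread1, hread2]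
  by_cases hout₂ : ((Valued.v ((α - 1) * (α - 1)) ≤ Valued.v ϖ ^ ℓ₂ ∧ Valued.v ((β - 1) * (β - 1)) ≤ Valued.v ϖ ^ ℓ₂ ∧ Valued.v (0 : K) ≤ Valued.v ϖ ^ ℓ₂) ∧
      Valued.v ((β - 1) * (β - 1) - (α - 1) * (α - 1)) ≤ Valued.v ϖ ^ (ℓ₂ + ρ)) ∧ ℓ₂ + ρ ≤ 2 * n₂
  · rw [if_pos hout₂, if_pos hout₂]
    by_cases hvac₁ : ℓ₁ + 2 * ρ ≤ n₂
    · -- `D₁` vacuous too: the token is its outer read, the cell is ★ κH's tube value `0`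
      rw [if_pos hvac₁, finsum_mem_sep_eq_ite_of_forall_iff (stratum σ ϖ T ![2 * ρ, 2 * ρ, 2 * ρ]) _ _
          (fun M hM => latticeInLevel_iff_outer_of_mem_stratum_H_of_vacuous hD T ρ hρ ℓ₁ n₂ _ hk₁ hloc₁ hvac₁ hM),
        finsum_kappaCount_mul_stabiliserWeight_hasAxis_H hD h2 hE hN₀ hT ρ hρ i f₀ hσf₀ (fun _ _ h _ => absurd h (by omega))]
      have hin : ¬ (n₁ = n₂ ∧ n₂ = n₃ ∧ n₁ < 2 * ρ ∧ 2 * ρ - n₁ ≤ n₁ - d + 1 ∧ d ≤ (2 * ρ - n₁ + 1) / 2) := fun h => absurd h.2.2.1 (by omega)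
      rw [if_neg hin]
      exact ite_self _
    · rw [if_neg hvac₁]
      by_cases hwit : ℓ₁ + 2 * ρ - n₂ ≤ n₃ - d + 1
      · have hf := hf₀ hwit
        rw [finsum_kappaCount_mul_stabiliserWeight_stratum_H_sep_onLocus_tube_of_witness hD h2 hE hT ρ hρ ⟨by omega, htube⟩ hn₃ i ℓ₁ n₂ _ hk₁ hloc₁
            (by omega) hσf₀ (by rw [glueRatio_modelToken_eq]; exact hf)]
        simp only [hout₁]
        simp only [h10₁, hpeq]
        by_cases hℓ : ℓ₁ + ρ ≤ n₂
        · rw [if_pos hℓ]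
          by_cases hrest : n₃ = n₂ ∧ 2 * d - 1 ≤ ℓ₁ + 2 * ρ - n₂
          · rw [if_pos hrest, if_pos ⟨hℓ, hrest.1, hwit, hrest.2⟩]
          · rw [if_neg hrest, if_neg (fun h => hrest ⟨h.2.1, h.2.2.2⟩)]
        · rw [if_neg hℓ, if_neg (fun h => hℓ h.1)]
      · rw [if_neg (fun h => hwit h.2.2.1)]
        refine finsum_kappaCount_mul_stabiliserWeight_stratum_H_sep_onLocus_tube_of_no_witness hD h2 hE hT ρ hρ ⟨by omega, htube⟩ hn₃ i ℓ₁ n₂ _ hk₁ hloc₁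
          (by omega) ?_
        rw [glueRatio_modelToken_eq]
        rintro ⟨f, hσf, hf⟩
        exact hwit (hbridge.1 ⟨f, hσf, hf⟩)
  · rw [if_neg hout₂, if_neg hout₂]

end Summit.HodgeConjecture.HodgeConjecture.Cruxes.H413.F0P3cDyRamLabelledKappaTwoTokenCoreHanging

end
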